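import Literature.Geometry.Lorentzian.FinalEraPackage2
import Summits.FinalStateConjecture.FinalStateConjecture.Theorems.UniversalWitnessFamily.Negative.MinkowskiSettled
import HarnessLib

/-!
# Stub `stub_minkowskiEra` (sanity) of line `dilated-leaves-virial-certificate` of crux
# `Capture` (stmt-FinalStateConjecture-10115): Minkowski space carries a rev-2 final-era package

The line `dilated-leaves-virial-certificate` of the crux `Capture` (routes `BartnikGapSettling` /
`QuietWindowCapture`, summit `FinalStateConjecture`) reduces the crux to ERA ENTRY: near-Kerr
leaves ⇒ `Nonempty (FinalEraPackage₂ 𝒟)` (`Literature/Geometry/Lorentzian/FinalEraPackage2.lean`,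
the 31-clause rev-2 final-era package of the route `DissipativeFinalMotions`).  Before this file
the structure `FinalEraPackage₂` had NO inhabitant anywhere in the tree (the route even lists "the
31-clause interface may be unsatisfiable as typed" as a risk).  This file proves the registered
sanity stub `stub_minkowskiEra` (verbatim signature): the Minkowski development
`Minkowski.vacuumCauchyDevelopment` of the trivial datum `(ℝ³, δ, 0)` carries the HONEST `N = 0`
rev-2 final-era package — anti-vacuity of the era statement at the model point.

The package (all 18 binders explicit): `N = 0` (no hole: `M, a, ξ, B, Ψ` are the empty
families), `T = 0`, `δ = 1`, `V = 0`, `C₁ = 0`, `C₂ = 1`, `ρ₀ = 1`, `κ = 0`, `β = 0`, flat domain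
`U₀ = E4`, flat background `Minkowski.backgroundOn ⊤`, flat chart the identity chart
`idFlatChart`, region `O = {x⁰ ≥ 0}` (`minkowskiExterior`), both from
`Theorems/UniversalWitnessFamily/Negative/MinkowskiSettled.lean`.  Of the 31 clauses, the 19
quantified over a hole index `i : Fin 0` are vacuous and the 7 sign/range clauses are numerals;
the five with content are discharged by the Minkowski lemmas of `MinkowskiSettled.lean`:
(O) `O = J⁺(ι ℝ³) ∩ I⁻(Ψ₀{x⁰ > 0})` by `J⁺({x⁰ = 0}) = {x⁰ ≥ 0}`
(`causalFuture_range_sliceEmbed`) and `I⁻({x⁰ > 0}) = ℝ⁴` (`chronologicalPast_late`); (F1) the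
identity chart is a late chart into `O` (`isLateChart_idFlatChart`); (F2) the flat domain is
everything; (F3) the deviation `Ψ₀^* η − η` vanishes identically (`deviationExtend_idFlatChart`,
`supCkENorm_zero`); (EX) a point of `O` not later than `τ₁` lies vertically below `(τ₁, x̲)` on
the flat slab `{x⁰ = τ₁}` (`Minkowski.mem_causalPast_vacuumCauchyDevelopment`; the pattern of
`hasExhaustiveCharts_minkowskiDecomp`).  No named facts are used and no definitions are
introduced (the package is assembled inside the proof by `FinalEraPackage₂.ofIsFinalEra₂`).

References: Christodoulou–Klainerman 1993, Thm. 1.0.2 (Minkowski space is its own final state);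
O'Neill 1983, Ch. 14, p. 402 (causality of `ℝ⁴₁`); Dafermos–Luk arXiv:1710.01722, p. 8 and
Conjecture 1 (the final-state picture the package renders).
-/

-- the doubled `FinalStateConjecture.FinalStateConjecture` path component trips dupNamespace
set_option linter.dupNamespace false

noncomputable section

namespace Summit.FinalStateConjecture.FinalStateConjecture.Theorems.BartnikGapSettling.Capture

open Set Filter Function Topology TopologicalSpace
open scoped Manifold ContDiff ENNReal
open Literature.Geometry.Lorentzian
-- `minkowskiExterior`, `idFlatChart` and their lemmas (the model point is settled)
open Summit.FinalStateConjecture.FinalStateConjecture.Theorems.UniversalWitnessFamily.Negative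

/-- **The honest `N = 0` rev-2 final era of Minkowski space, inline form.** The tuple
`(N, M, a, T, δ, V, C₁, C₂, ρ₀, κ, ξ, β, U₀, B₀, B, Ψ₀, Ψ, O) =
(0, !, !, 0, 1, 0, 0, 1, 1, 0, !, 0, ⊤, η on E4, !, id, !, {x⁰ ≥ 0})` (`!` the empty family)
satisfies the 31-clause predicate `CauchyDevelopment.IsFinalEra₂` in the Minkowski development
of the trivial datum: the hole-indexed clauses are vacuous, the flat chart is the identity (zero
deviation, late chart into `{x⁰ ≥ 0}`), `O = J⁺({x⁰ = 0}) ∩ I⁻({x⁰ > 0}) = {x⁰ ≥ 0}`, and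
exhaustion holds by vertical timelike segments. Christodoulou–Klainerman 1993, Thm. 1.0.2.
[cite: ChristodoulouKlainerman1993, Thm. 1.0.2] -/
private theorem isFinalEra₂_minkowski :
    Minkowski.vacuumCauchyDevelopment.toCauchyDevelopment.IsFinalEra₂ 0 Fin.elim0 Fin.elim0
      0 1 0 0 1 1 0 Fin.elim0 (fun _ ↦ 0) ⊤ (Minkowski.backgroundOn ⊤) (fun i ↦ i.elim0)
      idFlatChart (fun i ↦ i.elim0) minkowskiExterior := by
  refine ⟨?_, rfl, funext fun i ↦ i.elim0, fun i ↦ i.elim0, one_pos, le_rfl, one_pos, le_rfl,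
    le_rfl, one_pos, le_rfl, fun i ↦ i.elim0, fun _ _ i ↦ i.elim0, fun i ↦ i.elim0,
    MeasureTheory.integrableOn_zero, fun _ _ ↦ le_rfl, fun _ _ i ↦ i.elim0,
    isLateChart_idFlatChart, fun _ _ ↦ trivial, ?_, fun i ↦ i.elim0, fun i ↦ i.elim0,
    fun i ↦ i.elim0, fun i ↦ i.elim0, fun i ↦ i.elim0, fun i ↦ i.elim0, fun i ↦ i.elim0,
    fun i ↦ i.elim0, ?_, fun i ↦ i.elim0, fun i ↦ i.elim0⟩
  · -- (O) `O = J⁺(ι ℝ³) ∩ I⁻(Ψ₀ {x⁰ > 0})`: `J⁺({x⁰ = 0}) = {x⁰ ≥ 0}`, `I⁻({x⁰ > 0}) = ℝ⁴`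
    simp only [iUnion_of_empty, union_empty]
    refine Set.ext fun (x : E4) ↦ ⟨fun hx ↦ ⟨?_, ?_⟩, fun hx ↦ ?_⟩
    · exact (Set.ext_iff.mp causalFuture_range_sliceEmbed x).mpr hx
    · -- `I⁻({x⁰ > 0}) = ℝ⁴` and `{x⁰ > 0} ⊆ Ψ₀ {x⁰ > 0}` (the identity chart)
      have h1 := (Set.ext_iff.mp (chronologicalPast_late 0) x).mpr (mem_univ x)
      refine LorentzianMetric.chronologicalFuture_mono
        (M := Minkowski.vacuumCauchyDevelopment.carrier) ?_ h1
      exact fun y hy ↦ ⟨⟨y, trivial⟩, hy, rfl⟩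
    · exact (Set.ext_iff.mp causalFuture_range_sliceEmbed x).mp hx.1
  · -- (F3) far flatness: the deviation of the identity chart vanishes identically
    intro ε _
    refine ⟨0, 0, fun τ _ ↦ ?_⟩
    have h0 : Minkowski.vacuumCauchyDevelopment.toCauchyDevelopment.toSpacetime.deviationExtend
        (Minkowski.backgroundOn ⊤) idFlatChart = 0 :=
      deviationExtend_idFlatChart
    rw [h0, supCkENorm_zero]
    exact zero_le
  · -- (EX) exhaustion by vertical timelike segments (no certified zone: `N = 0`)
    intro τ₁ _
    simp only [iUnion_of_empty, union_empty]
    rintro (x : E4) hx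
    -- `x ∈ O` is not flat-late after `τ₁`: `x⁰ ≤ τ₁`
    have hxle : x 0 ≤ τ₁ := not_lt.mp fun hlt ↦ hx.2 ⟨⟨x, trivial⟩, hlt, rfl⟩
    -- so `x` lies vertically below `(τ₁, x̲)`, a point of the flat slab `{x⁰ = τ₁}`
    have hJ : x ∈ Minkowski.vacuumCauchyDevelopment.metric.causalPast
        Minkowski.vacuumCauchyDevelopment.timeOrientation
        ({E4.ofTimeSpace τ₁ (E4.spatial x)} : Set E4) := by
      refine Minkowski.mem_causalPast_vacuumCauchyDevelopment ?_
      simp only [E4.spatial_ofTimeSpace, sub_self, norm_zero, E4.ofTimeSpace_apply_zero, sub_nonneg]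
      exact hxle
    refine LorentzianMetric.causalFuture_mono (M := Minkowski.vacuumCauchyDevelopment.carrier)
      (singleton_subset_iff.mpr ?_) hJ
    exact ⟨⟨E4.ofTimeSpace τ₁ (E4.spatial x), trivial⟩, E4.ofTimeSpace_apply_zero τ₁ (E4.spatial x),
      rfl⟩

/-- **Anti-vacuity of the rev-2 final-era package at `N = 0`** (sanity stub `stub_minkowskiEra`
of line `dilated-leaves-virial-certificate`, crux `Capture`, stmt-FinalStateConjecture-10115):
Minkowski spacetime — the vacuum Cauchy development `Minkowski.vacuumCauchyDevelopment` of the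
trivial datum `(ℝ³, δ, 0)` — carries a rev-2 final-era package `FinalEraPackage₂` (no hole,
identity flat chart on all of `E4` after `T = 0`, region `{x⁰ ≥ 0}`, zero deviation): the first
inhabitant of `FinalEraPackage₂` in the tree, so the 31-clause interface is satisfiable as typed.
Christodoulou–Klainerman 1993, Thm. 1.0.2 (Minkowski space is its own final state).
[cite: ChristodoulouKlainerman1993, Thm. 1.0.2] -/
theorem stub_minkowskiEra :
    Nonempty (FinalEraPackage₂ Minkowski.vacuumCauchyDevelopment.toCauchyDevelopment) :=
  ⟨FinalEraPackage₂.ofIsFinalEra₂ isFinalEra₂_minkowski⟩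

end Summit.FinalStateConjecture.FinalStateConjecture.Theorems.BartnikGapSettling.Capture

end
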